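import Summits.BirchSwinnertonDyer.BirchSwinnertonDyer.Theorems.SchneiderFreeAdditiveX3StepLManinLinkOfKolyvagin
import HarnessLib

/-!
# Route `SchneiderFreeAdditiveX3` (rung K1 door): the repaired link `StepLManinLinkR` PROVED

Item `stmt-BirchSwinnertonDyer-19263` of route `route-BirchSwinnertonDyer-SchneiderFreeAdditiveX3`
(`Theses/SchneiderFreeAdditiveX3.lean`, rev 4/5, support, rank 9 — the REPAIR of item 19179
`StepLManinLink`, which is unprovable as typed: `StepLManin` displays `ord_p #Ш(E/K)` through
`shaOrder = Nat.card Ш(E/K)` (junk `0` when infinite) while the control socket counts `#Ш(E/K)[p^∞]`,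
and the passage needs the finiteness of `Ш(E/K)` at a non-torsion Heegner point — Kolyvagin, a printed
theorem no antecedent of 19179 supplied; door-c2 FINDING F2, P2 g8 restate 2026-08-26T03:50Z):

`StepLManinLinkR := (∀ N W K, kolyvagin N W K) → PotMultBranchIMC → GordTwoBranchIMC →
AnticycControlAdditive → StepLManin`.

It is EXACTLY seat door-c2's landed theorem `SchneiderFree.stepLManinLink_of_kolyvagin` (p418184,
`SchneiderFreeAdditiveX3StepLManinLinkOfKolyvagin.lean`: frame plumbing — anticyclotomic `ℤ_p`-extension
with a topological generator, a degree-one `𝔭 ∣ p` from `p ∣ N_E` and the Heegner hypothesis, the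
Tamagawa transport `ord_p ∏_{w∣N⁺} c_w(E/K) = 2·ord_p ∏_ℓ c_ℓ(E)` for every `p`, and
`ord_p #Ш(E/K)[p^∞] = ord_p #Ш(E/K)` for finite `Ш` — composed with the kernel-checked bookkeeping
`index_le_slack_of_additive_links`), curried once. Nothing is asserted: Kolyvagin's theorem and the three
analytic cruxes stay hypotheses of the item; the cruxes 19176/19177/19178 remain OPEN; BSD is not
advanced by any of this. Seat `bsd-schneider-door-c5` (gen 2), on P2 g8's turnkey («any prover seat»).

References: [Gross1991] Thm. 1.3 (Kolyvagin); [Kolyvagin1990] Thm. A; [JetchevSkinnerWan2017] §7.3.1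
(eq:tamK), §7.4.1 (eq:shalowerK-1) (arXiv:1512.06894 p. 30).
-/

set_option autoImplicit false
-- the summit-side namespace `Summit.BirchSwinnertonDyer.BirchSwinnertonDyer.…` (summit = problem) trips this linter
set_option linter.dupNamespace false

namespace Summit.BirchSwinnertonDyer.BirchSwinnertonDyer.Theorems

/-- **Item `StepLManinLinkR` of route `SchneiderFreeAdditiveX3` holds**: Kolyvagin's finiteness of
`Ш(E/K)` at a non-torsion Heegner point and the three analytic cruxes `PotMultBranchIMC`,
`GordTwoBranchIMC`, `AnticycControlAdditive` give the target `StepLManin` — by door-c2's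
`SchneiderFree.stepLManinLink_of_kolyvagin` (frame plumbing + `index_le_slack_of_additive_links` +
Tamagawa transport + `ord_p #Ш[p^∞] = ord_p #Ш` for finite `Ш`). [cite: Gross1991, Thm. 1.3]
[cite: JetchevSkinnerWan2017, §7.4.1 (arXiv p. 30)] -/
theorem schneiderFreeAdditiveX3_stepLManinLinkR_proof :
    Summit.BirchSwinnertonDyer.BirchSwinnertonDyer.Theses.SchneiderFreeAdditiveX3.StepLManinLinkR :=
  fun hKo ↦ SchneiderFree.stepLManinLink_of_kolyvagin hKo

end Summit.BirchSwinnertonDyer.BirchSwinnertonDyer.Theorems
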